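import Literature.NumberTheory.LFunctions.ConreyMollifier
import HarnessLib

/-!
# Conrey 1989, Theorem 2 (the mollified mean square, `θ < 4/7`) for Conrey's own data: the one
# named leaf of `conrey_bound`, and the assembly

Topic `Literature/NumberTheory/LFunctions`; rh.S15. Fact decomposition (librarian,
`fact-decompose`, human ruling 2026-08-16) of the budget-capped named fact
`Literature.NumberTheory.LFunctions.conrey_bound : 0.4088 ≤ κ` (`ZeroCounting.lean`; J. B. Conrey,
*More than two fifths of the zeros of the Riemann zeta function are on the critical line*,
J. reine angew. Math. 399 (1989), 1–26, Thm. 1 with the Note added in proof, p. 25).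

## The printed proof and what the tree already proves of it

Conrey's Theorem 1 (`κ ≥ 0.4077`, improved to `κ > 0.4088` in the Note added in proof) is
Levinson's method (§3, "Beginning of the proof": `κ ≥ 1 − R⁻¹ log c`, (38)) fed with the one
analytic input, **Theorem 2** (p. 8): for `V(s) = Q(−L⁻¹ d/ds) ζ(s)` mollified by
`B(s, P) = Σ_{n ≤ y} μ(n) P(log(y/n)/log y) n^{σ₀ − 1/2 − s}`, `y = T^θ`, **`θ < 4/7`**,
`σ₀ = ½ − R/L`, `∫ |V B(σ₀ + it)|² dt ∼ c(P, Q, R, θ) T` with the printed constant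
`c = 1 + θ⁻¹ ∫₀¹∫₀¹ e^{2Rv} (Q(v)P′(u) + θQ′(v)P(u) + θRQ(v)P(u))² du dv`; its proof (§§4–9) is the
Balasubramanian–Conrey–Heath-Brown evaluation of the twisted mean square pushed to `θ < 4/7` by
the Deshouillers–Iwaniec bounds for averages of Kloosterman sums. The tree PROVES everything but
Theorem 2: Levinson's method in Conrey's form (`levinson_criticalLineProportion_ge`), the
admissibility of Conrey's mollifier (`conreyMollifier_admissible`, `ConreyMollifier.lean`), the
data of the Note (`conrey1989Q`, with `Q + Q∘(1−X) = 0.984`, `Q(0) = 1`), the closed form of the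
double integral and the numerical inequality `0.4088 ≤ 1 − log c / 1.28` (`conrey1989_numerics`,
`ZeroCountingConreyProofs.lean`), assembled in `conrey_bound_of_conrey1989_meanValue_mollifier`,
whose ONLY hypothesis is the displayed statement vendored below. (The tenured prove seat's exit,
2026-08-16: "needs-split: conrey_bound → Conrey1989_theorem2_conreyV".)

## Contents

* `Conrey1989_theorem2_conreyV` — NAMED FACT (the child): Theorem 2 of the paper for the data of
  the Note added in proof, in the form the tree's Levinson framework consumes (see the docstring:
  Conrey's exact-identity variant `conreyV` of `V`, dyadic ranges `[T, 2T]`, an `ε`-upper bound in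
  place of `∼`, and an explicit cubic `P`).
* `conrey_bound_holds_of` — PROVED assembly: the child implies `conrey_bound`.

## References

* J. B. Conrey, J. reine angew. Math. 399 (1989), 1–26: Thm. 1 (p. 4), Thm. 2 (p. 8), (38) (p. 6),
  §4 (p. 9, the choice of `P`), Note added in proof (p. 25). [Conrey1989]
* J. B. Conrey, *Zeros of derivatives of Riemann's ξ-function on the critical line*, J. Number
  Theory 16 (1983), 49–74, §4 (the exact-identity `V`; Lemma 4). [Conrey1983]
* H. M. Bui, B. Conrey, M. P. Young, Acta Arith. 150 (2011), 35–64, Thm. 3.1 and (3.3) (Theorem 2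
  restated with its constant). [BuiConreyYoung2010]
* J.-M. Deshouillers, H. Iwaniec, *Kloosterman sums and Fourier coefficients of cusp forms*,
  Invent. Math. 70 (1982/83); *Power mean-values for Dirichlet's polynomials and the Riemann
  zeta-function II*, Acta Arith. 43 (1984) (the input behind `θ < 4/7`).
-/

noncomputable section

open Complex Polynomial Set Filter MeasureTheory intervalIntegral
open scoped Real

namespace Literature.NumberTheory.LFunctions

/-! ### The child: Theorem 2 for the data of the Note added in proof -/

/-- **Conrey 1989, Theorem 2, for Conrey's own data** (p. 8: "Theorem 2. Suppose `θ < 4/7` …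
`∫₁^T |V B(σ₀ + it, P)|² dt ∼ c(P, Q, R, θ) T`", with `B(s, P) = Σ_{n ≤ y} μ(n) P(log(y/n)/log y)
n^{σ₀−1/2−s}`, `y = T^θ`, `σ₀ = ½ − R/L`, `L = log T`, `V(s) = Q(−L⁻¹ d/ds) ζ(s)`, `P(0) = 0`,
`P(1) = 1`, `Q(0) = 1`, and
`c(P, Q, R, θ) = 1 + θ⁻¹ ∫₀¹∫₀¹ e^{2Rv} (Q(v)P′(u) + θQ′(v)P(u) + θRQ(v)P(u))² du dv`; the instance
used for "`κ > 0.4088`" is the Note added in proof, p. 25: `R = 1.28`,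
`Q(x) = 0.492 + 0.602(1−2x) − 0.08(1−2x)³ − 0.06(1−2x)⁵ + 0.046(1−2x)⁷`). In Lean, for the
data `Q = conrey1989Q`, `P = conrey1989P` (the explicit cubic stand-in `0.8525x − 0.0173x² +
0.1648x³` for Conrey's optimal non-polynomial `P`, p. 9 — Theorem 2 is stated for every such
polynomial `P`), `R = 32/25`, `θ = conrey1989Theta = 0.5714 < 4/7`, mollifier coefficients
`conreyMollifierCoeff P θ R T` (`ConreyMollifier.lean`) and constant `conrey1989Const = c(P, Q,
1.28, 0.5714)` (`ZeroCountingConreyProofs.lean`): for every `ε > 0`, for all large `T`,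
`∫_T^{2T} |B(σ₀ + it, P) · V(σ₀ + it)|² dt ≤ (c + ε) T`. TWO renderings differ from the print and
are exactly what Conrey's proof delivers: (i) `V` is the tree's `conreyV conrey1989Q (log T)`,
Conrey's exact-identity variant `Q(−L⁻¹δ)𝓡 + χ·(Q∘(1−X))(L⁻¹δ)K` of 1983 (§4 (1)–(2)) on which the
tree's Levinson framework `levinson_criticalLineProportion_ge` is built — it agrees with
`Q(−L⁻¹ d/ds)ζ` to leading order (`χ'/χ = −L + O(1/t)`, Conrey 1983, Lemma 4; approximate functional
equation `norm_conreyV_sub_afe_le`, `ConreyVApproxFunctionalEq.lean`) and has the same main term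
`c(P, Q, R, θ)`; (ii) the range is dyadic, `[T, 2T]` with `L = log T`, and `∼` is weakened to the
`ε`-upper bound, which is all that Littlewood's lemma consumes (Conrey (38); the printed asymptotic
over `[1, T]` with parameters at scale `T` gives it, the proof being uniform in `t ≍ T`). This is
verbatim the hypothesis `hms` of `conrey_bound_of_conrey1989_meanValue_mollifier`. Size XL: the
proof is §§4–9 of the paper (Balasubramanian–Conrey–Heath-Brown for the twisted mean square,
Deshouillers–Iwaniec's bounds for averages of Kloosterman sums for `1/2 ≤ θ < 4/7`).
[cite: Conrey1989, Thm 2 (p. 8) with (39) and the Note added in proof (p. 25)]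
[cite: BuiConreyYoung2010, Thm. 3.1 and (3.3)] -/
def Conrey1989_theorem2_conreyV : Prop :=
  ∀ ε > 0, ∀ᶠ T : ℝ in atTop,
    ∫ t in T..2 * T, ‖(∑ n ∈ Finset.Icc 1 ⌊T ^ conrey1989Theta⌋₊,
        conreyMollifierCoeff conrey1989P conrey1989Theta (32 / 25) T n *
          (n : ℂ) ^ (-((((1 / 2 - (32 / 25) / Real.log T : ℝ)) : ℂ) + t * I))) *
      conreyV conrey1989Q (Real.log T) (((1 / 2 - (32 / 25) / Real.log T : ℝ) : ℂ) + t * I)‖ ^ 2 ≤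
      (conrey1989Const + ε) * T

/-! ### Assembly -/

/-- **Assembly of the split of `conrey_bound`**: Conrey's Theorem 2 for his data
(`Conrey1989_theorem2_conreyV`) implies `κ ≥ 0.4088` — Levinson's method in Conrey's form, the
admissibility of the mollifier and the verified numerics `0.4088 ≤ 1 − log c / 1.28`, all proved
in the tree (`conrey_bound_of_conrey1989_meanValue_mollifier`, `ConreyMollifier.lean`).
[cite: Conrey1989, Thm 1 (p. 4), (38) and the Note added in proof (p. 25)] -/
theorem conrey_bound_holds_of : Conrey1989_theorem2_conreyV → conrey_bound :=
  fun hms => conrey_bound_of_conrey1989_meanValue_mollifier hms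

end Literature.NumberTheory.LFunctions

end
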